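import Literature.MathematicalPhysics.KineticTheory.ReyBelletThomas2002JointDensity
import Literature.MathematicalPhysics.KineticTheory.ReyBelletThomas2002Thm21
import Mathlib.Analysis.Calculus.BumpFunction.FiniteDimension
import HarnessLib

/-!
# Rey-Bellet–Thomas 2002, Theorem 2.1: positivity of the invariant density from irreducibility, via duality

Trunk T-KINETIC (Literature/MathematicalPhysics/KineticTheory). Inline decomposition step for the
named fact `ReyBelletThomas2002_thm21` (provefact unit): the clause "`μ` has a `C^∞` EVERYWHERE
POSITIVE density" WITHOUT assuming positive transition densities. Inputs: the jointly continuous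
transition densities `p_t(x, y)` (`ReyBelletThomas2002JointDensity.lean`), the duality
`dx P_t(x, dy) = e^{2γt} dy P̂_t(y, dx)` with the Feller kernels `P̂_t` of the reversed equation
(`ReyBelletThomas2002Reversal.lean`), and IRREDUCIBILITY (every nonempty open set is charged from
every point at some positive time — Prop. 4.2 of the paper):

* `rb_isClosed_setOf_kernel_eq_zero` — with continuous densities, `{z | P_t(z, U) = 0}` is closed
  (Fatou along sequences), so `{z | P_t(z, U) > 0}` is open;
* `rb_measure_pos_of_isOpen` — an invariant probability measure of an irreducible semigroup with
  continuous densities charges every nonempty open set (Lindelöf: countably many times suffice);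
* `rb_exists_pos_density` — **for every `y₀` some `p_1(x₀, y₀) > 0`**: by duality,
  `∫ φ(x) p_1(x, y) dx = e^{2γ} ∫ φ dP̂_1(y, ·)` for EVERY `y` (a.e. by testing, everywhere by
  continuity of both sides), and `P̂_1(y₀, ·)` is a probability measure;
* `rb_hasSmoothPosDensity_of_lintegral_pos`, `rb_hasSmoothPosDensity_of_irreducible` — the smooth
  invariant density `ρ` is everywhere positive: `ρ(y₀) ≥ ∫ ρ(x) p_1(x, y₀) dx` (invariance,
  Tonelli, Fatou along the dense a.e.-set, continuity of `ρ`) and the right side is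
  `≥ c μ(B(x₀, δ)) > 0`.

## References

* L. Rey-Bellet, L. E. Thomas, Comm. Math. Phys. 225 (2002) 305–329, Thm 2.1, Prop. 4.2, §5.
-/

noncomputable section

open MeasureTheory ProbabilityTheory Filter Topology Set Function Metric
open scoped NNReal ENNReal ContDiff BoundedContinuousFunction

namespace Literature.MathematicalPhysics.KineticTheory.HeatConduction

open Literature.Analysis.Distribution Literature.Probability.Process

variable {N : ℕ}

namespace MarkovSemigroupFor

variable {P : OscillatorChain} {Λ T_L T_R : ℝ} (S : MarkovSemigroupFor (P.rbGenerator Λ N T_L T_R))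

/-! ### Continuous densities: open-set masses are lower semicontinuous in the starting point -/

/-- With transition densities continuous in the starting point, `{z | P_t(z, U) = 0}` is closed
(Fatou along a convergent sequence: `P_t(z₀, U) ≤ liminf P_t(z_n, U)`). [folklore] -/
theorem rb_isClosed_setOf_kernel_eq_zero {t : ℝ≥0} {p : RBPhaseSpace N → RBPhaseSpace N → ℝ}
    (hpc : Continuous fun q : RBPhaseSpace N × RBPhaseSpace N => p q.1 q.2)
    (hpt : ∀ x, S.kernel t x =
      (volume : Measure (RBPhaseSpace N)).withDensity fun y => ENNReal.ofReal (p x y))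
    (U : Set (RBPhaseSpace N)) (hU : MeasurableSet U) : IsClosed {z : RBPhaseSpace N | S.kernel t z U = 0} := by
  refine IsSeqClosed.isClosed fun u z₀ hu hut => ?_
  set F : RBPhaseSpace N → RBPhaseSpace N → ℝ≥0∞ := fun z y => U.indicator (fun y => ENNReal.ofReal (p z y)) y with hF
  have hFm : ∀ z, Measurable (F z) := fun z =>
    (ENNReal.measurable_ofReal.comp (hpc.comp (Continuous.prodMk_right z)).measurable).indicator hU
  have hval : ∀ z, S.kernel t z U = ∫⁻ y, F z y := fun z => by
    rw [hpt z, withDensity_apply _ hU, ← lintegral_indicator hU]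
  have hlim : ∀ y, Tendsto (fun n => F (u n) y) atTop (𝓝 (F z₀ y)) := fun y => by
    by_cases hy : y ∈ U
    · simp only [hF, indicator_of_mem hy]
      exact ((ENNReal.continuous_ofReal.comp hpc).tendsto (z₀, y)).comp (hut.prodMk_nhds tendsto_const_nhds)
    · simp only [hF, indicator_of_notMem hy]
      exact tendsto_const_nhds
  show S.kernel t z₀ U = 0
  rw [hval]
  refine le_antisymm ?_ zero_le
  calc ∫⁻ y, F z₀ y = ∫⁻ y, liminf (fun n => F (u n) y) atTop := lintegral_congr fun y => ((hlim y).liminf_eq).symm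
    _ ≤ liminf (fun n => ∫⁻ y, F (u n) y) atTop := lintegral_liminf_le fun n => hFm _
    _ = liminf (fun _ => (0 : ℝ≥0∞)) atTop := liminf_congr (Eventually.of_forall fun n => by rw [← hval]; exact hu n)
    _ = 0 := liminf_const 0

/-- **An invariant probability measure of an irreducible semigroup with continuous densities
charges every nonempty open set** (`μ(U) = ∫ P_t(z, U) μ(dz)`; the open sets `{P_t(·, U) > 0}`,
`t > 0`, cover `X`, countably many suffice, one of them has positive `μ`-measure).
[cite: ReyBelletThomas2002, §5] -/
theorem rb_measure_pos_of_isOpen {p : ℝ → RBPhaseSpace N → RBPhaseSpace N → ℝ}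
    (hpc : ContinuousOn (fun w : ℝ × RBPhaseSpace N × RBPhaseSpace N => p w.1 w.2.1 w.2.2) (Set.Ioi (0 : ℝ) ×ˢ Set.univ))
    (hpt : ∀ t : ℝ≥0, 0 < t → ∀ x : RBPhaseSpace N,
      S.kernel t x = (volume : Measure (RBPhaseSpace N)).withDensity fun y => ENNReal.ofReal (p t x y))
    (hirr : ∀ (z : RBPhaseSpace N) (U : Set (RBPhaseSpace N)), IsOpen U → U.Nonempty →
      ∃ t : ℝ≥0, 0 < t ∧ 0 < S.kernel t z U)
    {μ : Measure (RBPhaseSpace N)} [IsProbabilityMeasure μ] (hinv : S.IsInvariant μ)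
    {U : Set (RBPhaseSpace N)} (hU : IsOpen U) (hne : U.Nonempty) : 0 < μ U := by
  -- slices at positive times are continuous in `(x, y)`
  have hslice : ∀ t : ℝ≥0, 0 < t → Continuous fun q : RBPhaseSpace N × RBPhaseSpace N => p t q.1 q.2 := by
    intro t ht
    have h1 : ContinuousOn (fun q : RBPhaseSpace N × RBPhaseSpace N => (((t : ℝ≥0) : ℝ), q)) univ :=
      (Continuous.prodMk_right ((t : ℝ≥0) : ℝ)).continuousOn
    have h2 := hpc.comp h1 fun q _ => ⟨NNReal.coe_pos.2 ht, mem_univ _⟩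
    exact continuousOn_univ.1 h2
  -- the open sets `O_t = {P_t(·, U) > 0}`
  set O : ℝ≥0 → Set (RBPhaseSpace N) := fun t => {z | S.kernel t z U = 0}ᶜ with hO
  have hOo : ∀ t : {t : ℝ≥0 // 0 < t}, IsOpen (O t.1) := fun t =>
    (S.rb_isClosed_setOf_kernel_eq_zero (hslice t.1 t.2) (hpt t.1 t.2) U hU.measurableSet).isOpen_compl
  have hcover : ⋃ t : {t : ℝ≥0 // 0 < t}, O t.1 = univ := by
    refine eq_univ_of_forall fun z => ?_
    obtain ⟨t, ht, hpos⟩ := hirr z U hU hne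
    exact mem_iUnion.2 ⟨⟨t, ht⟩, by simp [hO, hpos.ne']⟩
  obtain ⟨T, hTc, hTU⟩ := TopologicalSpace.isOpen_iUnion_countable (fun t : {t : ℝ≥0 // 0 < t} => O t.1) hOo
  rw [hcover] at hTU
  -- some `O_t`, `t ∈ T`, has positive `μ`-measure
  have hex : ∃ t ∈ T, 0 < μ (O t.1) := by
    by_contra hall
    have hall' : ∀ t ∈ T, μ (O t.1) = 0 := fun t ht =>
      nonpos_iff_eq_zero.1 (not_lt.1 fun h => hall ⟨t, ht, h⟩)
    have h0 : μ (⋃ t ∈ T, O t.1) = 0 := (measure_biUnion_null_iff hTc).2 hall'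
    rw [hTU, measure_univ] at h0
    exact one_ne_zero h0
  obtain ⟨t, -, hμt⟩ := hex
  -- `μ U = ∫ P_t(z, U) μ(dz) ≥ ∫_{O_t} > 0`
  rw [← hinv.lintegral_kernel S t.1 hU.measurableSet]
  have hm : Measurable fun z => S.kernel t.1 z U := (S.kernel t.1).measurable_coe hU.measurableSet
  refine pos_iff_ne_zero.2 fun h0 => ?_
  have hae := (lintegral_eq_zero_iff hm).1 h0
  have : μ (O t.1) = 0 := ae_iff.1 hae
  exact hμt.ne' this

/-! ### Positivity of a smooth invariant density -/

/-- **A smooth invariant density is everywhere positive as soon as `∫ p(x, y₀) μ(dx) > 0` for every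
`y₀`** (continuous transition densities at one time; variant of
`rb_hasSmoothPosDensity_of_pos_density` with its positivity input weakened to the integrated form).
[cite: ReyBelletThomas2002, Thm 2.1] -/
theorem rb_hasSmoothPosDensity_of_lintegral_pos {μ : Measure (RBPhaseSpace N)} [IsProbabilityMeasure μ]
    (hinv : S.IsInvariant μ) {g : RBPhaseSpace N → ℝ} (hg : ContDiff ℝ ∞ g)
    (hμ : μ = (volume : Measure (RBPhaseSpace N)).withDensity fun x => ENNReal.ofReal (g x))
    {t : ℝ≥0} {p : RBPhaseSpace N → RBPhaseSpace N → ℝ}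
    (hpc : Continuous fun q : RBPhaseSpace N × RBPhaseSpace N => p q.1 q.2)
    (hpt : ∀ x, S.kernel t x =
      (volume : Measure (RBPhaseSpace N)).withDensity fun y => ENNReal.ofReal (p x y))
    (hGpos' : ∀ y₀, 0 < ∫⁻ x, ENNReal.ofReal (p x y₀) ∂μ) : HasSmoothPosDensity μ := by
  haveI := isAddHaarMeasure_volume_rbPhaseSpace N
  refine ⟨g, hg, fun y₀ => ?_, hμ⟩
  set F : RBPhaseSpace N × RBPhaseSpace N → ℝ≥0∞ := fun q => ENNReal.ofReal (p q.1 q.2) with hF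
  have hFm : Measurable F := ENNReal.measurable_ofReal.comp hpc.measurable
  set G : RBPhaseSpace N → ℝ≥0∞ := fun y => ∫⁻ x, F (x, y) ∂μ with hGdef
  have hGm : Measurable G := hFm.lintegral_prod_left'
  have hgm : Measurable fun y => ENNReal.ofReal (g y) :=
    ENNReal.measurable_ofReal.comp hg.continuous.measurable
  have heq : (volume : Measure (RBPhaseSpace N)).withDensity (fun y => ENNReal.ofReal (g y)) =
      (volume : Measure (RBPhaseSpace N)).withDensity G := by
    refine Measure.ext fun A hA => ?_
    rw [← hμ, ← hinv.lintegral_kernel S t hA, withDensity_apply _ hA]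
    have h1 : ∀ x, S.kernel t x A = ∫⁻ y in A, F (x, y) ∂volume := fun x => by
      rw [hpt x, withDensity_apply _ hA]
    simp_rw [h1]
    rw [lintegral_lintegral_swap (f := fun x y => F (x, y))
      (hFm.comp (measurable_fst.prodMk measurable_snd)).aemeasurable]
  have hae : (fun y => ENNReal.ofReal (g y)) =ᵐ[(volume : Measure (RBPhaseSpace N))] G :=
    (withDensity_eq_iff_of_sigmaFinite hgm.aemeasurable hGm.aemeasurable).1 heq
  have hGpos : 0 < G y₀ := hGpos' y₀
  have hdense : Dense {y : RBPhaseSpace N | ENNReal.ofReal (g y) = G y} := Measure.dense_of_ae hae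
  obtain ⟨u, hu, hut⟩ := mem_closure_iff_seq_limit.1 (hdense.closure_eq.symm ▸ mem_univ y₀ :
    y₀ ∈ closure {y : RBPhaseSpace N | ENNReal.ofReal (g y) = G y})
  have hGle : G y₀ ≤ ENNReal.ofReal (g y₀) := by
    have hlim : ∀ x, Tendsto (fun n => F (x, u n)) atTop (𝓝 (F (x, y₀))) := fun x =>
      ((ENNReal.continuous_ofReal.comp hpc).tendsto (x, y₀)).comp
        (tendsto_const_nhds.prodMk_nhds hut)
    calc G y₀ = ∫⁻ x, liminf (fun n => F (x, u n)) atTop ∂μ :=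
          lintegral_congr fun x => ((hlim x).liminf_eq).symm
      _ ≤ liminf (fun n => ∫⁻ x, F (x, u n) ∂μ) atTop :=
          lintegral_liminf_le fun n => hFm.comp (measurable_id.prodMk measurable_const)
      _ = liminf (fun n => ENNReal.ofReal (g (u n))) atTop :=
          liminf_congr (Eventually.of_forall fun n => (hu n).symm)
      _ = ENNReal.ofReal (g y₀) :=
          (((ENNReal.continuous_ofReal.comp hg.continuous).tendsto y₀).comp hut).liminf_eq
  exact ENNReal.ofReal_pos.1 (hGpos.trans_le hGle)

end MarkovSemigroupFor

/-! ### For every `y₀` some `p_1(x₀, y₀) > 0`, by duality -/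

namespace OscillatorChain

variable (P : OscillatorChain)

section Pos

variable {P} {k₁ k₂ : ℝ} (hU : RBGrowth P.U k₁) (hV : RBGrowth P.V k₂) (hk₁ : 1 ≤ k₁) (hk₂ : 1 ≤ k₂)
  (hγ : 0 ≤ P.γ) (Λ : ℝ) (T_L T_R : ℝ)
include hU hV hk₁ hk₂ hγ

/-- **Every `y₀` is reached with positive density from somewhere**: if `P_1(x, dy) = p(x, y) dy`
with `(x, y) ↦ p(x, y)` continuous and `≥ 0`, then for every `y₀` there is `x₀` with `p(x₀, y₀) > 0`
— by duality `∫ φ(x) p(x, y) dx = e^{2γ} ∫ φ dP̂_1(y, ·)` for every `y` (a.e. by testing against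
`ψ(y)`, everywhere by continuity), and `P̂_1(y₀, ·)` is a probability measure. [folklore] -/
theorem rb_exists_pos_density {p : RBPhaseSpace N → RBPhaseSpace N → ℝ}
    (hpc : Continuous fun q : RBPhaseSpace N × RBPhaseSpace N => p q.1 q.2) (hp0 : ∀ x y, 0 ≤ p x y)
    (hpt : ∀ x, P.rbKernel Λ N T_L T_R 1 x =
      (volume : Measure (RBPhaseSpace N)).withDensity fun y => ENNReal.ofReal (p x y))
    (y₀ : RBPhaseSpace N) : ∃ x₀, 0 < p x₀ y₀ := by
  haveI := isAddHaarMeasure_volume_rbPhaseSpace N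
  haveI : IsMarkovKernel (P.rbRevKernel Λ N T_L T_R 1) := isMarkovKernel_rbRevKernel hU hV hk₁ hk₂ hγ Λ N T_L T_R 1
  haveI : IsMarkovKernel (P.rbKernel Λ N T_L T_R 1) := P.isMarkovKernel_rbKernel hU hV hk₁ hk₂ hγ Λ N T_L T_R 1
  -- a large ball charged by `P̂_1(y₀, ·)`, and a smooth cut-off `φ = 1` on it
  set ν : Measure (RBPhaseSpace N) := P.rbRevKernel Λ N T_L T_R 1 y₀ with hν
  have hballs : Tendsto (fun n : ℕ => ν (closedBall (0 : RBPhaseSpace N) n)) atTop (𝓝 (ν univ)) := by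
    have hmono : Monotone fun n : ℕ => closedBall (0 : RBPhaseSpace N) n := fun m n hmn =>
      closedBall_subset_closedBall (by exact_mod_cast hmn)
    have hU : ⋃ n : ℕ, closedBall (0 : RBPhaseSpace N) n = univ :=
      eq_univ_of_forall fun x => mem_iUnion.2 (by
        obtain ⟨n, hn⟩ := exists_nat_ge ‖x‖
        exact ⟨n, mem_closedBall_zero_iff.2 hn⟩)
    rw [← hU]
    exact tendsto_measure_iUnion_atTop hmono
  have hev : ∀ᶠ n : ℕ in atTop, (1 / 2 : ℝ≥0∞) < ν (closedBall (0 : RBPhaseSpace N) n) := by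
    refine hballs.eventually (lt_mem_nhds ?_)
    rw [measure_univ]; norm_num
  obtain ⟨n, hn⟩ := hev.exists
  let b : ContDiffBump (0 : RBPhaseSpace N) := ⟨n + 1, n + 2, by positivity, by linarith⟩
  set φ : RBPhaseSpace N → ℝ := fun x => b x with hφdef
  have hφs : ContDiff ℝ ∞ φ := b.contDiff
  have hφc : HasCompactSupport φ := b.hasCompactSupport
  have hφ0 : ∀ x, 0 ≤ φ x := fun x => b.nonneg
  have hφ1 : ∀ x, φ x ≤ 1 := fun x => b.le_one
  have hφball : ∀ x ∈ closedBall (0 : RBPhaseSpace N) n, φ x = 1 := fun x hx =>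
    b.one_of_mem_closedBall (closedBall_subset_closedBall (by show (n : ℝ) ≤ n + 1; linarith) hx)
  -- the two sides, as functions of `y`
  set A : RBPhaseSpace N → ℝ := fun y => ∫ x, φ x * p x y with hA
  set B : RBPhaseSpace N → ℝ := fun y => ∫ x, φ x ∂(P.rbRevKernel Λ N T_L T_R 1 y) with hB
  obtain ⟨Cφ, hCφ⟩ := hφs.continuous.bounded_above_of_compact_support hφc
  have hBc : Continuous B := continuous_integral_rbRevKernel hU hV hk₁ hk₂ hγ Λ N T_L T_R 1 hφs.continuous hCφ
  have hAc : Continuous A := by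
    refine continuous_iff_continuousAt.2 fun y₁ => ?_
    have hK : IsCompact (tsupport φ ×ˢ closedBall y₁ 1) := hφc.prod (isCompact_closedBall y₁ 1)
    obtain ⟨M, hM⟩ := hK.exists_bound_of_continuousOn hpc.continuousOn
    have hφi : Integrable φ volume := hφs.continuous.integrable_of_hasCompactSupport hφc
    refine continuousAt_of_dominated (bound := fun x => ‖φ x‖ * max M 0) ?_ ?_ (hφi.norm.mul_const _) ?_
    · exact Eventually.of_forall fun y => (hφs.continuous.mul (hpc.comp (Continuous.prodMk_left y))).aestronglyMeasurable
    · filter_upwards [closedBall_mem_nhds y₁ one_pos] with y hy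
      refine Eventually.of_forall fun x => ?_
      rw [norm_mul]
      by_cases hx : x ∈ tsupport φ
      · exact mul_le_mul_of_nonneg_left ((hM (x, y) ⟨hx, hy⟩).trans (le_max_left _ _)) (norm_nonneg _)
      · rw [image_eq_zero_of_notMem_tsupport hx, norm_zero, zero_mul, zero_mul]
    · exact Eventually.of_forall fun x => (continuous_const.mul (hpc.comp (Continuous.prodMk_right x))).continuousAt
  -- testing against `ψ(y)`: `∫ ψ (A - e^{2γ} B) = 0`
  have htest : ∀ ψ : RBPhaseSpace N → ℝ, ContDiff ℝ ∞ ψ → HasCompactSupport ψ →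
      ∫ y, ψ y • (A y - Real.exp (2 * P.γ * ((1 : ℝ≥0) : ℝ)) * B y) = 0 := by
    intro ψ hψ hψc
    set H : RBPhaseSpace N × RBPhaseSpace N → ℝ := fun q => φ q.1 * ψ q.2 with hH
    have hHc : Continuous H := (hφs.continuous.comp continuous_fst).mul (hψ.continuous.comp continuous_snd)
    have hHs : HasCompactSupport H := by
      refine IsCompact.of_isClosed_subset (hφc.isCompact.prod hψc.isCompact) (isClosed_tsupport _) ?_
      refine closure_minimal (fun q hq => ?_) ((isClosed_tsupport _).prod (isClosed_tsupport _))
      have h := Function.mem_support.1 hq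
      exact ⟨subset_tsupport _ (Function.mem_support.2 (left_ne_zero_of_mul h)),
        subset_tsupport _ (Function.mem_support.2 (right_ne_zero_of_mul h))⟩
    have hint : Integrable H ((volume : Measure (RBPhaseSpace N)) ⊗ₘ P.rbKernel Λ N T_L T_R 1) :=
      (P.rbConfinedDrift hU hV hk₁ hk₂ hγ Λ N).integrable_compProd_pair
        (P.rbNoiseVec_mem N T_L T_R 0) (P.rbNoiseVec_mem N T_L T_R 1) volume hHc hHs 1
    obtain ⟨-, hdual⟩ := rb_integral_kernel_duality hU hV hk₁ hk₂ hγ Λ N T_L T_R one_pos hint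
    -- the left side: density and Fubini
    have hψi : Integrable ψ volume := hψ.continuous.integrable_of_hasCompactSupport hψc
    have hinner : ∀ x, ∫ y, H (x, y) ∂(P.rbKernel Λ N T_L T_R 1 x) = φ x * ∫ y, p x y * ψ y := by
      intro x
      simp only [hH]
      rw [integral_const_mul, hpt x]
      congr 1
      have hmf : Measurable fun y => (p x y).toNNReal :=
        (hpc.comp (Continuous.prodMk_right x)).measurable.real_toNNReal
      have h2 := integral_withDensity_eq_integral_smul (μ := (volume : Measure (RBPhaseSpace N))) hmf ψ
      show ∫ a, ψ a ∂((volume : Measure (RBPhaseSpace N)).withDensity fun y => ((p x y).toNNReal : ℝ≥0∞)) = _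
      rw [h2]
      refine integral_congr_ae (Eventually.of_forall fun y => ?_)
      simp only [NNReal.smul_def, smul_eq_mul, Real.coe_toNNReal _ (hp0 x y)]
    have hprod : Integrable (fun q : RBPhaseSpace N × RBPhaseSpace N => φ q.1 * (p q.1 q.2 * ψ q.2))
        ((volume : Measure (RBPhaseSpace N)).prod volume) := by
      have hc : Continuous fun q : RBPhaseSpace N × RBPhaseSpace N => φ q.1 * (p q.1 q.2 * ψ q.2) :=
        (hφs.continuous.comp continuous_fst).mul (hpc.mul (hψ.continuous.comp continuous_snd))
      refine hc.integrable_of_hasCompactSupport ?_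
      refine IsCompact.of_isClosed_subset (hφc.isCompact.prod hψc.isCompact) (isClosed_tsupport _) ?_
      refine closure_minimal (fun q hq => ?_) ((isClosed_tsupport _).prod (isClosed_tsupport _))
      have h := Function.mem_support.1 hq
      exact ⟨subset_tsupport _ (Function.mem_support.2 (left_ne_zero_of_mul h)),
        subset_tsupport _ (Function.mem_support.2 (right_ne_zero_of_mul (right_ne_zero_of_mul h)))⟩
    have hleft : ∫ x, ∫ y, H (x, y) ∂(P.rbKernel Λ N T_L T_R 1 x) = ∫ y, ψ y * A y := by
      simp_rw [hinner]
      have h1 : ∀ x, φ x * ∫ y, p x y * ψ y = ∫ y, φ x * (p x y * ψ y) := fun x => (integral_const_mul _ _).symm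
      simp_rw [h1]
      rw [integral_integral_swap hprod]
      refine integral_congr_ae (Eventually.of_forall fun y => ?_)
      simp only [hA]
      rw [← integral_const_mul]
      refine integral_congr_ae (Eventually.of_forall fun x => ?_)
      ring
    have hright : ∫ y, ∫ x, H (x, y) ∂(P.rbRevKernel Λ N T_L T_R 1 y) = ∫ y, ψ y * B y := by
      refine integral_congr_ae (Eventually.of_forall fun y => ?_)
      simp only [hH, hB]
      rw [← integral_const_mul]
      refine integral_congr_ae (Eventually.of_forall fun x => ?_)
      ring
    rw [hleft, hright, ← integral_const_mul] at hdual
    have hiA : Integrable (fun y => ψ y * A y) := (hψ.continuous.mul hAc).integrable_of_hasCompactSupport hψc.mul_right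
    have hiB : Integrable (fun y => Real.exp (2 * P.γ * ((1 : ℝ≥0) : ℝ)) * (ψ y * B y)) :=
      ((hψ.continuous.mul hBc).integrable_of_hasCompactSupport hψc.mul_right).const_mul _
    simp only [smul_eq_mul, mul_sub]
    have e : (fun y => ψ y * (Real.exp (2 * P.γ * ((1 : ℝ≥0) : ℝ)) * B y)) =
        fun y => Real.exp (2 * P.γ * ((1 : ℝ≥0) : ℝ)) * (ψ y * B y) := funext fun y => by ring
    rw [integral_sub hiA (by rw [e]; exact hiB), e, hdual, sub_self]
  -- a.e., then everywhere by continuity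
  have hcont : Continuous fun y => A y - Real.exp (2 * P.γ * ((1 : ℝ≥0) : ℝ)) * B y := hAc.sub (continuous_const.mul hBc)
  have hae := ae_eq_zero_of_integral_contDiff_smul_eq_zero hcont.locallyIntegrable htest
  have hae' : (fun y => A y - Real.exp (2 * P.γ * ((1 : ℝ≥0) : ℝ)) * B y) =ᵐ[volume] fun _ => (0 : ℝ) := hae
  have hfun := (Continuous.ae_eq_iff_eq (volume : Measure (RBPhaseSpace N)) hcont continuous_const).1 hae'
  have hzero : A y₀ = Real.exp (2 * P.γ * ((1 : ℝ≥0) : ℝ)) * B y₀ := sub_eq_zero.1 (congrFun hfun y₀)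
  -- `B y₀ > 0`
  have hBpos : 0 < B y₀ := by
    have hφi : Integrable φ ν := by
      refine (integrable_const Cφ).mono' hφs.continuous.aestronglyMeasurable (Eventually.of_forall fun x => hCφ x)
    have hind : Integrable ((closedBall (0 : RBPhaseSpace N) n).indicator fun _ => (1 : ℝ)) ν :=
      (integrable_const 1).indicator measurableSet_closedBall
    have hle : ∫ x, (closedBall (0 : RBPhaseSpace N) n).indicator (fun _ => (1 : ℝ)) x ∂ν ≤ ∫ x, φ x ∂ν := by
      refine integral_mono hind hφi fun x => ?_
      by_cases hx : x ∈ closedBall (0 : RBPhaseSpace N) n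
      · rw [indicator_of_mem hx, hφball x hx]
      · rw [indicator_of_notMem hx]; exact hφ0 x
    rw [integral_indicator_const _ measurableSet_closedBall, smul_eq_mul, mul_one] at hle
    have hreal : 0 < ν.real (closedBall (0 : RBPhaseSpace N) n) := by
      rw [measureReal_def]
      refine ENNReal.toReal_pos ?_ (measure_ne_top _ _)
      exact (lt_trans (by norm_num) hn).ne'
    exact hreal.trans_le hle
  have hApos : 0 < A y₀ := by rw [hzero]; exact mul_pos (Real.exp_pos _) hBpos
  -- some `p(x₀, y₀) > 0`
  by_contra hall
  have hall' : ∀ x, p x y₀ ≤ 0 := fun x => not_lt.1 fun h => hall ⟨x, h⟩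
  have hp00 : ∀ x, p x y₀ = 0 := fun x => le_antisymm (hall' x) (hp0 x y₀)
  have hA0 : A y₀ = 0 := by
    simp only [hA, hp00, mul_zero, integral_zero]
  exact hApos.ne' hA0

end Pos

/-! ### The invariant density is positive under irreducibility -/

section Invariant

variable {P} {k₁ k₂ : ℝ} (hU : RBGrowth P.U k₁) (hV : RBGrowth P.V k₂) (hk₁ : 1 ≤ k₁) (hk₂ : 1 ≤ k₂)
  (hγ : 0 ≤ P.γ) (Λ : ℝ) (T_L T_R : ℝ)
include hU hV hk₁ hk₂ hγ

/-- **The smooth invariant density is everywhere positive under irreducibility.** For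
`S : MarkovSemigroupFor (P.rbGenerator …)` whose kernels ARE the constructed `rbKernel`, jointly
continuous transition densities `p`, an invariant probability measure `μ = ρ · Leb` with `ρ ∈ C^∞`,
and irreducibility (every nonempty open set is charged from every point at some positive time):
`ρ > 0` everywhere (no positivity of `p` is assumed: `∫ ρ(x) p_1(x, y₀) dx ≥ c μ(B(x₀, δ)) > 0` with
`p_1(x₀, y₀) > 0` from the duality and `μ(B) > 0` from irreducibility).
[cite: ReyBelletThomas2002, Thm 2.1] -/
theorem rb_hasSmoothPosDensity_of_irreducible (S : MarkovSemigroupFor (P.rbGenerator Λ N T_L T_R))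
    (hSk : ∀ t, S.kernel t = P.rbKernel Λ N T_L T_R t)
    {p : ℝ → RBPhaseSpace N → RBPhaseSpace N → ℝ}
    (hpc : ContinuousOn (fun w : ℝ × RBPhaseSpace N × RBPhaseSpace N => p w.1 w.2.1 w.2.2) (Set.Ioi (0 : ℝ) ×ˢ Set.univ))
    (hp0 : ∀ t : ℝ, 0 < t → ∀ x y, 0 ≤ p t x y)
    (hpt : ∀ t : ℝ≥0, 0 < t → ∀ x : RBPhaseSpace N,
      S.kernel t x = (volume : Measure (RBPhaseSpace N)).withDensity fun y => ENNReal.ofReal (p t x y))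
    (hirr : ∀ (z : RBPhaseSpace N) (U : Set (RBPhaseSpace N)), IsOpen U → U.Nonempty →
      ∃ t : ℝ≥0, 0 < t ∧ 0 < S.kernel t z U)
    {μ : Measure (RBPhaseSpace N)} [IsProbabilityMeasure μ] (hinv : S.IsInvariant μ)
    {g : RBPhaseSpace N → ℝ} (hg : ContDiff ℝ ∞ g)
    (hμ : μ = (volume : Measure (RBPhaseSpace N)).withDensity fun x => ENNReal.ofReal (g x)) :
    HasSmoothPosDensity μ := by
  haveI := isAddHaarMeasure_volume_rbPhaseSpace N
  -- the densities at time `1`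
  have hp1 : Continuous fun q : RBPhaseSpace N × RBPhaseSpace N => p 1 q.1 q.2 := by
    have h1 : ContinuousOn (fun q : RBPhaseSpace N × RBPhaseSpace N => ((1 : ℝ), q)) univ :=
      (Continuous.prodMk_right (1 : ℝ)).continuousOn
    exact continuousOn_univ.1 (hpc.comp h1 fun q _ => ⟨(zero_lt_one : (0 : ℝ) < 1), mem_univ _⟩)
  have hpt1 : ∀ x, S.kernel 1 x =
      (volume : Measure (RBPhaseSpace N)).withDensity fun y => ENNReal.ofReal (p 1 x y) := fun x => by
    simpa using hpt 1 one_pos x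
  have hpt1' : ∀ x, P.rbKernel Λ N T_L T_R 1 x =
      (volume : Measure (RBPhaseSpace N)).withDensity fun y => ENNReal.ofReal (p 1 x y) := fun x => by
    rw [← hSk]; exact hpt1 x
  refine S.rb_hasSmoothPosDensity_of_lintegral_pos hinv hg hμ hp1 hpt1 fun y₀ => ?_
  -- `∫ p_1(x, y₀) μ(dx) ≥ c μ(B(x₀, δ)) > 0`
  obtain ⟨x₀, hx₀⟩ := rb_exists_pos_density hU hV hk₁ hk₂ hγ Λ T_L T_R hp1 (hp0 1 one_pos) hpt1' y₀
  have hcx : ContinuousAt (fun x => p 1 x y₀) x₀ := (hp1.comp (Continuous.prodMk_left y₀)).continuousAt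
  obtain ⟨δ, hδ, hball⟩ := Metric.continuousAt_iff.1 hcx (p 1 x₀ y₀ / 2) (by positivity)
  have hlow : ∀ x ∈ ball x₀ δ, p 1 x₀ y₀ / 2 ≤ p 1 x y₀ := by
    intro x hx
    have h := hball hx
    rw [Real.dist_eq, abs_lt] at h
    linarith [h.1]
  have hμB : 0 < μ (ball x₀ δ) :=
    S.rb_measure_pos_of_isOpen hpc hpt hirr hinv isOpen_ball ⟨x₀, mem_ball_self hδ⟩
  have hmeas : Measurable fun x => ENNReal.ofReal (p 1 x y₀) :=
    ENNReal.measurable_ofReal.comp (hp1.comp (Continuous.prodMk_left y₀)).measurable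
  calc (0 : ℝ≥0∞) < ENNReal.ofReal (p 1 x₀ y₀ / 2) * μ (ball x₀ δ) :=
        ENNReal.mul_pos (ENNReal.ofReal_pos.2 (by positivity)).ne' hμB.ne'
    _ = ∫⁻ _ in ball x₀ δ, ENNReal.ofReal (p 1 x₀ y₀ / 2) ∂μ := by rw [setLIntegral_const]
    _ ≤ ∫⁻ x in ball x₀ δ, ENNReal.ofReal (p 1 x y₀) ∂μ :=
        setLIntegral_mono hmeas fun x hx => ENNReal.ofReal_le_ofReal (hlow x hx)
    _ ≤ ∫⁻ x, ENNReal.ofReal (p 1 x y₀) ∂μ := setLIntegral_le_lintegral _ _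

end Invariant

end OscillatorChain

end Literature.MathematicalPhysics.KineticTheory.HeatConduction
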